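import Literature.AnabelianGeometry.SemiGraphs.TemperedFunctorialityProofs
import Literature.AnabelianGeometry.SemiGraphs.TemperedCoveringsLimitsProofs
import Literature.AnabelianGeometry.SemiGraphs.TemperoidsHomProofs
import HarnessLib

/-!
# Semi-graphs of anabelioids, §3, Proposition 3.6 (iv) — part 2: the pull-back functor is exact

Mochizuki, *Semi-graphs of anabelioids*, Publ. RIMS **42** (2006), §3, Proposition 3.6 (iv)
(manuscript p. 39) [cite: MochizukiSemiAnbd2006, Prop 3.6(iv) p.39]: a morphism `G' → G` "induces a
morphism of temperoids `B^temp(G') → B^temp(G)`" — a morphism of temperoids being (Def. 3.1 (iii)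
p. 33) a functor preserving finite limits and countable colimits.  Continuing
`TemperedFunctorialityProofs.lean` (`covPullback F : B^cov(G) ⥤ B^cov(G')`): finite limits and
countable colimits in `B^cov(−)` are computed fibre by fibre (abc-iut-L3-d4,
`TemperedCoveringsLimitsProofs.lean`), so they are DETECTED fibre by fibre (a cone whose restrictions
to all `Π_v`, `Π_e` are limit cones is a limit cone — proved here), and `F^*` followed by restriction to
`v'` is restriction to `F v'` followed by `B^temp(F_{v'})`, which preserves them (abc-iut-L3-d2,
`btempRes_preserves(Co)LimitsOfShape`); hence `F^*` preserves finite limits and countable colimits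
on `B^cov`.  The passage to the full subcategories `B^temp(−)` and to `π₁^temp` (Prop. 3.2) is the
next part.  No definitions; nothing here takes a side on
[IUTchIII] Cor. 3.12.
-/

noncomputable section

namespace Literature.AnabelianGeometry.SemiGraphs

namespace ProfiniteSemiGraph

open CategoryTheory CategoryTheory.Limits

universe u

variable {𝒢' 𝒢 : ProfiniteSemiGraph.{u}}

namespace CovObj

/-! ### Isomorphisms and (co)limits of `B^cov(G)` are detected fibre by fibre -/

/-- A morphism of `B^cov(G)` that is an isomorphism on every vertex and edge fibre is an isomorphism
(the inverse is compatible with the gluings). [cite: MochizukiSemiAnbd2006, §3 p.36] -/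
theorem isIso_of_components {S T : CovObj 𝒢} (f : S ⟶ T) [hV : ∀ v, IsIso (f.fV v)]
    [hE : ∀ e, IsIso (f.fE e)] : IsIso f := by
  refine ⟨⟨⟨fun v => inv (f.fV v), fun e => inv (f.fE e), fun b v h => ?_⟩, ?_, ?_⟩⟩
  · rw [Functor.map_inv, IsIso.inv_comp_eq, ← Category.assoc, IsIso.eq_comp_inv]
    exact (f.comm b v h).symm
  · exact hom_ext' _ _ (fun v => IsIso.hom_inv_id (f.fV v)) (fun e => IsIso.hom_inv_id (f.fE e))
  · exact hom_ext' _ _ (fun v => IsIso.inv_hom_id (f.fV v)) (fun e => IsIso.inv_hom_id (f.fE e))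

section Limits

variable {J : Type} [SmallCategory J] [FinCategory J]

/-- **Finite limits of `B^cov(G)` are detected fibre by fibre**: a cone whose restrictions to every
`B^temp(Π_v)` and `B^temp(Π_e)` are limit cones is a limit cone.
[cite: MochizukiSemiAnbd2006, §3 p.36] -/
theorem isLimitOfComponents {K : J ⥤ CovObj 𝒢} (c : Cone K)
    (hV : ∀ v, IsLimit ((restrictV 𝒢 v).mapCone c)) (hE : ∀ e, IsLimit ((restrictE 𝒢 e).mapCone c)) :
    Nonempty (IsLimit c) := by
  obtain ⟨ℓ, hℓ, hℓV, hℓE⟩ := exists_limitCone K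
  let φ : c ⟶ ℓ := hℓ.liftConeMorphism c
  haveI : ∀ v, IsIso (φ.hom.fV v) := fun v => by
    have h1 := IsLimit.hom_isIso (hV v) (hℓV v).some ((Cone.functoriality K (restrictV 𝒢 v)).map φ)
    exact ((Cone.forget _).mapIso (@asIso _ _ _ _ _ h1)).isIso_hom
  haveI : ∀ e, IsIso (φ.hom.fE e) := fun e => by
    have h1 := IsLimit.hom_isIso (hE e) (hℓE e).some ((Cone.functoriality K (restrictE 𝒢 e)).map φ)
    exact ((Cone.forget _).mapIso (@asIso _ _ _ _ _ h1)).isIso_hom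
  haveI : IsIso φ.hom := isIso_of_components φ.hom
  haveI : IsIso φ := Cone.cone_iso_of_hom_iso φ
  exact ⟨hℓ.ofIsoLimit (asIso φ).symm⟩

end Limits

section Colimits

variable {J : Type} [SmallCategory J] [CountableCategory J]

/-- **Countable colimits of `B^cov(G)` are detected fibre by fibre**: a cocone whose restrictions to
every `B^temp(Π_v)` and `B^temp(Π_e)` are colimit cocones is a colimit cocone.
[cite: MochizukiSemiAnbd2006, §3 p.36] -/
theorem isColimitOfComponents {K : J ⥤ CovObj 𝒢} (c : Cocone K)
    (hV : ∀ v, IsColimit ((restrictV 𝒢 v).mapCocone c))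
    (hE : ∀ e, IsColimit ((restrictE 𝒢 e).mapCocone c)) : Nonempty (IsColimit c) := by
  obtain ⟨ℓ, hℓ, hℓV, hℓE⟩ := exists_colimitCocone K
  let φ : ℓ ⟶ c := hℓ.descCoconeMorphism c
  haveI : ∀ v, IsIso (φ.hom.fV v) := fun v => by
    have h1 := IsColimit.hom_isIso (hℓV v).some (hV v)
      ((Cocone.functoriality K (restrictV 𝒢 v)).map φ)
    exact ((Cocone.forget _).mapIso (@asIso _ _ _ _ _ h1)).isIso_hom
  haveI : ∀ e, IsIso (φ.hom.fE e) := fun e => by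
    have h1 := IsColimit.hom_isIso (hℓE e).some (hE e)
      ((Cocone.functoriality K (restrictE 𝒢 e)).map φ)
    exact ((Cocone.forget _).mapIso (@asIso _ _ _ _ _ h1)).isIso_hom
  haveI : IsIso φ.hom := isIso_of_components φ.hom
  haveI : IsIso φ := Cocone.cocone_iso_of_hom_iso φ
  exact ⟨hℓ.ofIsoColimit (asIso φ)⟩

end Colimits

end CovObj

namespace Hom

variable (F : Hom 𝒢' 𝒢)

/-- **`F^* : B^cov(G) ⥤ B^cov(G')` preserves finite limits** (restriction to `v'` after `F^*` is
restriction to `F v'` followed by `B^temp(F_{v'})`, both of which preserve finite limits, and limits of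
`B^cov(G')` are detected fibre by fibre). [cite: MochizukiSemiAnbd2006, Prop 3.6(iv) p.39] -/
theorem preservesLimitsOfShape_covPullback (J : Type) [SmallCategory J] [FinCategory J] :
    PreservesLimitsOfShape J F.covPullback := by
  haveI : ∀ v, PreservesLimitsOfShape J (restrictV 𝒢 v) :=
    fun v => CovObj.preservesLimitsOfShape_restrictV 𝒢 v
  haveI : ∀ e, PreservesLimitsOfShape J (restrictE 𝒢 e) :=
    fun e => CovObj.preservesLimitsOfShape_restrictE 𝒢 e
  haveI : ∀ v', PreservesLimitsOfShape J (BTemp.res (F.hV v')) :=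
    fun v' => btempRes_preservesLimitsOfShape (F.hV v') J
  haveI : ∀ e', PreservesLimitsOfShape J (BTemp.res (F.hE e')) :=
    fun e' => btempRes_preservesLimitsOfShape (F.hE e') J
  refine ⟨fun {K} => ⟨fun {c} hc => CovObj.isLimitOfComponents _ (fun v' => ?_) (fun e' => ?_)⟩⟩
  · change IsLimit ((F.covPullback ⋙ restrictV 𝒢' v').mapCone c)
    rw [F.covPullback_comp_restrictV v']
    exact isLimitOfPreserves _ hc
  · change IsLimit ((F.covPullback ⋙ restrictE 𝒢' e').mapCone c)
    rw [F.covPullback_comp_restrictE e']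
    exact isLimitOfPreserves _ hc

/-- `F^*` preserves finite limits. [cite: MochizukiSemiAnbd2006, Prop 3.6(iv) p.39] -/
theorem preservesFiniteLimits_covPullback : PreservesFiniteLimits F.covPullback :=
  ⟨fun J _ _ => F.preservesLimitsOfShape_covPullback J⟩

/-- **`F^* : B^cov(G) ⥤ B^cov(G')` preserves countable colimits.**
[cite: MochizukiSemiAnbd2006, Prop 3.6(iv) p.39] -/
theorem preservesColimitsOfShape_covPullback (J : Type) [SmallCategory J] [CountableCategory J] :
    PreservesColimitsOfShape J F.covPullback := by
  haveI : ∀ v, PreservesColimitsOfShape J (restrictV 𝒢 v) :=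
    fun v => CovObj.preservesColimitsOfShape_restrictV 𝒢 v
  haveI : ∀ e, PreservesColimitsOfShape J (restrictE 𝒢 e) :=
    fun e => CovObj.preservesColimitsOfShape_restrictE 𝒢 e
  haveI : ∀ v', PreservesColimitsOfShape J (BTemp.res (F.hV v')) :=
    fun v' => btempRes_preservesColimitsOfShape (F.hV v') J
  haveI : ∀ e', PreservesColimitsOfShape J (BTemp.res (F.hE e')) :=
    fun e' => btempRes_preservesColimitsOfShape (F.hE e') J
  refine ⟨fun {K} => ⟨fun {c} hc => CovObj.isColimitOfComponents _ (fun v' => ?_) (fun e' => ?_)⟩⟩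
  · change IsColimit ((F.covPullback ⋙ restrictV 𝒢' v').mapCocone c)
    rw [F.covPullback_comp_restrictV v']
    exact isColimitOfPreserves _ hc
  · change IsColimit ((F.covPullback ⋙ restrictE 𝒢' e').mapCocone c)
    rw [F.covPullback_comp_restrictE e']
    exact isColimitOfPreserves _ hc

end Hom

end ProfiniteSemiGraph

end Literature.AnabelianGeometry.SemiGraphs

end
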